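import Summits.QuantumFields.YangMills.Theorems.BalabanUVNodesN15AtSpineCarriers
import Summits.QuantumFields.YangMills.Theorems.BalabanUVNodesN15VectorPieceBackgroundFirstOrder

/-!
# YM-DAG node N15 (= NE2) AT THE RATE CARRIERS OF RECORD, RE-KEYED WITH THE BACKGROUND BLOCK LIVE: the K4 stub `YMDAG.UVSplit.S_N15 RRec` closed over every
# rate-carrier predicate whose NE2 component carries one of the three realised background families of the U = 1 vector piece — the OPERATOR layer
# HYPOTHESIS-FREE by name ((3.35) consumed, size guard live), the site-kernel and unit-lattice layers displayed

Track A of `YM-PLAN.md` (cell `pub-ymgap`, HUMAN RULING D-0062), node **N15**, FAN-OUT v1.1 §N15 row s2 («KNIT AT THE SPINE CARRIERS: re-key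
`Thm/BalabanUVNodesN15AtSpineCarriers.lean` … so that A1–A4 + part 24 + B1 enter BY NAME»); typed by seat `pub-ymgap-dag-n15-c` (generation g0) after its row s1
(the mixed piece, parts `…DefectKernelVectorPieceMixed` ∕ `…VectorPieceMixed` ∕ `…VectorPieceBackgroundFirstOrder`).  Shape twin and import: n27-a's
`BalabanUVNodesN15AtSpineCarriers` (p424026; same namespace, nothing restated — its closers `s_N15_of_layersReading` ∕ `…_of_covarianceTowerRateReading` ∕
`…_of_kingLeavesReading` take the operator layer as a DISPLAYED hypothesis because «no background producer exists in the tree»; now three do).  Producers consumed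
BY NAME: n15-a part 27 `VectorPiece.ne2PlusOperator_vectorPiece_background` (zeroth-order species, n15-b A4 instantiated), this seat's
`VectorPiece.ne2PlusOperator_vectorPiece_background₁` (first-order species, n15-b B4 instantiated) and `VectorPiece.ne2PlusOperator_vectorPiece_gauge` (abelian
gauge field live, n15-b C2 instantiated).  Kernel bookkeeping: 0 `def`, 0 `sorry`, standard axioms.  COUNT-NEUTRAL; `--supports` the K3 item `SpineGivenEndpointR11`
(stmt-QuantumFields-19676).

THE STUB.  `S_N15 RRec := ∀ F D g₀ os R, RRec F D g₀ os R → N15At R.ne2`, `N15At c := NE2PlusOperator c.c35 c.pi c.Kop ∧ NE2PlusSite 4 c.p c.c35 c.pi c.Ksite ∧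
NE2PlusUnit c.c35 c.pi c.Kunit c.inΛ c.unitDist`.

WHAT THIS MODULE IS.
* §1 THE NODE FACES WITH THE BACKGROUND LIVE: **`n15At_vectorPiece_background_of_layers`** (zeroth-order species), **`n15At_vectorPiece_background₁_of_layers`**
  (first-order species), **`n15At_vectorPiece_gauge_of_layers`** (gauge field live) — for `d + 1 ≥ 2`, `L ≥ 1`, `c₃₅ > 0`, on the NE2 carriers whose index is the
  sized family `VecIndexS d L`, whose paired instances are the realised background instances (background carriers = the (3.35) letter pairs with the index's OWN
  `M`: guard LIVE) and whose operator kernels are the CONSTRUCTED background-dependent families, `N15At` follows from the site-kernel and unit-lattice layers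
  ALONE — the operator conjunct is the producer's theorem.
* §2 (W2) CLOSERS, refinement-generic: **`s_N15_of_backgroundReading`**, **`s_N15_of_background₁Reading`**, **`s_N15_of_gaugeReading`** — a rate-record predicate
  handing, with every bundle it pins, the identification of `R.ne2` with such carriers plus the two remaining layers has `S_N15`.
* §3 GUARD: `not_n15At_iff_site_or_unit_fails_background₁` — on these carriers `N15At` FAILS iff the site OR the unit layer fails (the operator layer can no
  longer be the reason); the rate-less refutation and the empty-index trap of the twin file apply verbatim (not restated).

HONEST FRAMING.  NE2 is NOT PRINTED beyond King's scalar template and NOT PROVED for Bałaban's `G(U)`.  What enters hypothesis-free is the operator layer of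
the LINEAR (U = 1) vector single-scale piece of [B5]∕[B6]∕King (4.42) dressed by n15-b's ABELIAN coefficient ∕ gauge-field species with linearised block-average
transport (parts 27 ∕ `…BackgroundFirstOrder`); NOT the matrix (`ad`) coefficients, NOT the (C3) nonlinear transport, NOT the multiscale carrier of NODE 00; the
SITE-KERNEL and UNIT-LATTICE layers of `N15At` remain DISPLAYED (no producer with the background live exists in the tree; the unit layer's typed sockets are
n15-a's `N15Knit.N15unit_of_covarianceTowerRate` ∕ `N15unit_of_kingLeaves`).  N15 is NOT discharged (0∕1 at every record); typed 28∕28, discharged count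
untouched; one finite four-torus programme at fixed `ε` — NOT ℝ⁴, NOT infinite volume, NOT OS, NOT a mass gap, NOT Clay.  Restate-immune.  No decl below
carries a cite tag.
-/

noncomputable section

open Finset

namespace Summit.QuantumFields.YangMills.Theorems.N15AtSpineCarriers

open Literature.MathematicalPhysics.QuantumFieldTheory.Balaban1983to89
open Literature.MathematicalPhysics.QuantumFieldTheory.Balaban1983to89.T4Continuum
open Literature.MathematicalPhysics.QuantumFieldTheory.Balaban1983to89.B9 (SiteKernel)
open Literature.MathematicalPhysics.QuantumFieldTheory.Balaban1983to89.T4EtaRate (PairedInstance NE2PlusOperator NE2PlusSite NE2PlusUnit)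
open Summit.QuantumFields.YangMills.BalabanUVNodes.N15.VectorPiece (VecIndexS bgVecInstance bgVecFamily bgVecInstance₁ bgVecFamily₁4 gaugeVecInstance
  gaugeVecFamily4 ne2PlusOperator_vectorPiece_background ne2PlusOperator_vectorPiece_background₁ ne2PlusOperator_vectorPiece_gauge)
open YMDAG.UVSplit (Datum NE2Carriers RateCarriers RateRecordPred N15At RatesAt S_N15)

variable {N : ℕ} [NeZero N] {d : ℕ} {L : ℕ} [NeZero L]

/-! ## §1 The node faces with the background block live: `N15At` from the site and unit layers alone -/

section Faces

/-- **`N15At` WITH THE ZEROTH-ORDER BACKGROUND SPECIES LIVE, FROM THE SITE AND UNIT LAYERS ALONE.**  On the NE2 carriers indexed by the sized family, with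
paired instances n15-a part 27's `bgVecInstance` (coefficient carriers = the (3.35) letter pair, guard = the index's `M`) and operator kernels `bgVecFamily`
(n15-b A1∕A3's constructed pair fed with the -a pieces), the operator conjunct is `VectorPiece.ne2PlusOperator_vectorPiece_background` (hypothesis-free for
`d + 1 ≥ 2`, `L ≥ 1`, `c₃₅ > 0`); `N15At` follows from the two displayed layers. [bookkeeping] -/
theorem n15At_vectorPiece_background_of_layers (hd : 1 ≤ d) (hL : 1 ≤ L) {c35 : ℝ} (hc35 : 0 < c35) (p : ℝ)
    (Ksite Kunit : ∀ j : VecIndexS d L, SiteKernel (bgVecInstance (d := d) L hL j).gc (bgVecInstance (d := d) L hL j).Bf)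
    (inΛ : ∀ j : VecIndexS d L, (bgVecInstance (d := d) L hL j).gc.Site → Prop)
    (unitDist : ∀ j : VecIndexS d L, (bgVecInstance (d := d) L hL j).gc.Site → (bgVecInstance (d := d) L hL j).gc.Site → ℝ)
    (hsite : NE2PlusSite 4 p c35 (bgVecInstance (d := d) L hL) Ksite)
    (hunit : NE2PlusUnit c35 (bgVecInstance (d := d) L hL) Kunit inΛ unitDist) :
    N15At { I := VecIndexS d L, c35 := c35, p := p, pi := bgVecInstance (d := d) L hL, Kop := bgVecFamily (d := d) L hL,
            Ksite := Ksite, Kunit := Kunit, inΛ := inΛ, unitDist := unitDist } :=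
  ⟨ne2PlusOperator_vectorPiece_background (d := d) hd hL c35 hc35, hsite, hunit⟩

/-- **`N15At` WITH THE FIRST-ORDER BACKGROUND SPECIES LIVE, FROM THE SITE AND UNIT LAYERS ALONE.**  As above with this seat's `bgVecInstance₁` ∕ `bgVecFamily₁4`
(first-order coefficient carriers `(c′, (a′_μ)_μ)`, n15-b B1–B3's stacked constructed pair, all four (3.42) entries incl. the (3.44)-shaped mixed pair); the
operator conjunct is `VectorPiece.ne2PlusOperator_vectorPiece_background₁`. [bookkeeping] -/
theorem n15At_vectorPiece_background₁_of_layers (hd : 1 ≤ d) (hL : 1 ≤ L) {c35 : ℝ} (hc35 : 0 < c35) (p : ℝ)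
    (Ksite Kunit : ∀ j : VecIndexS d L, SiteKernel (bgVecInstance₁ (d := d) L hL j).gc (bgVecInstance₁ (d := d) L hL j).Bf)
    (inΛ : ∀ j : VecIndexS d L, (bgVecInstance₁ (d := d) L hL j).gc.Site → Prop)
    (unitDist : ∀ j : VecIndexS d L, (bgVecInstance₁ (d := d) L hL j).gc.Site → (bgVecInstance₁ (d := d) L hL j).gc.Site → ℝ)
    (hsite : NE2PlusSite 4 p c35 (bgVecInstance₁ (d := d) L hL) Ksite)
    (hunit : NE2PlusUnit c35 (bgVecInstance₁ (d := d) L hL) Kunit inΛ unitDist) :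
    N15At { I := VecIndexS d L, c35 := c35, p := p, pi := bgVecInstance₁ (d := d) L hL, Kop := bgVecFamily₁4 (d := d) L hL,
            Ksite := Ksite, Kunit := Kunit, inΛ := inΛ, unitDist := unitDist } :=
  ⟨ne2PlusOperator_vectorPiece_background₁ (d := d) hd hL c35 hc35, hsite, hunit⟩

/-- **`N15At` WITH THE (ABELIAN) GAUGE FIELD LIVE, FROM THE SITE AND UNIT LAYERS ALONE.**  As above with this seat's `gaugeVecInstance` ∕ `gaugeVecFamily4`
(configurations = gauge fields `A′`, (3.35) consumed on `A′` itself, the perturbation derived from `A′` by n15-b C1's exponential species); the operator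
conjunct is `VectorPiece.ne2PlusOperator_vectorPiece_gauge`. [bookkeeping] -/
theorem n15At_vectorPiece_gauge_of_layers (hd : 1 ≤ d) (hL : 1 ≤ L) {c35 : ℝ} (hc35 : 0 < c35) (p : ℝ)
    (Ksite Kunit : ∀ j : VecIndexS d L, SiteKernel (gaugeVecInstance (d := d) L hL j).gc (gaugeVecInstance (d := d) L hL j).Bf)
    (inΛ : ∀ j : VecIndexS d L, (gaugeVecInstance (d := d) L hL j).gc.Site → Prop)
    (unitDist : ∀ j : VecIndexS d L, (gaugeVecInstance (d := d) L hL j).gc.Site → (gaugeVecInstance (d := d) L hL j).gc.Site → ℝ)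
    (hsite : NE2PlusSite 4 p c35 (gaugeVecInstance (d := d) L hL) Ksite)
    (hunit : NE2PlusUnit c35 (gaugeVecInstance (d := d) L hL) Kunit inΛ unitDist) :
    N15At { I := VecIndexS d L, c35 := c35, p := p, pi := gaugeVecInstance (d := d) L hL, Kop := gaugeVecFamily4 (d := d) L hL,
            Ksite := Ksite, Kunit := Kunit, inΛ := inΛ, unitDist := unitDist } :=
  ⟨ne2PlusOperator_vectorPiece_gauge (d := d) hd hL c35 hc35, hsite, hunit⟩

end Faces

/-! ## §2 (W2) closers: `S_N15` for every rate-record predicate whose NE2 component IS such a background family plus the two remaining layers -/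

section Closers

/-- **`S_N15` FOR EVERY ZEROTH-ORDER-BACKGROUND READING.**  If `RRec` hands, with every bundle `R` it pins, an identification of `R.ne2` with the NE2 carriers of
§1 (zeroth-order species; any `c₃₅ > 0`, exponent `p`, site ∕ unit kernels, region and unit distance) together with the site-kernel and unit-lattice layers on
them, then `S_N15 RRec` — the operator layer is NOT a hypothesis. [bookkeeping] -/
theorem s_N15_of_backgroundReading (hd : 1 ≤ d) (hL : 1 ≤ L) (RRec : RateRecordPred N)
    (hread : ∀ (F : T4Family) (D : Datum F N) (g₀ : ℕ → ℝ) (os : List (ULoop F)) (R : RateCarriers N), RRec F D g₀ os R →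
      ∃ (c35 p : ℝ) (Ksite Kunit : ∀ j : VecIndexS d L, SiteKernel (bgVecInstance (d := d) L hL j).gc (bgVecInstance (d := d) L hL j).Bf)
        (inΛ : ∀ j : VecIndexS d L, (bgVecInstance (d := d) L hL j).gc.Site → Prop)
        (unitDist : ∀ j : VecIndexS d L, (bgVecInstance (d := d) L hL j).gc.Site → (bgVecInstance (d := d) L hL j).gc.Site → ℝ),
        0 < c35 ∧
        R.ne2 = { I := VecIndexS d L, c35 := c35, p := p, pi := bgVecInstance (d := d) L hL, Kop := bgVecFamily (d := d) L hL,
                  Ksite := Ksite, Kunit := Kunit, inΛ := inΛ, unitDist := unitDist } ∧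
        NE2PlusSite 4 p c35 (bgVecInstance (d := d) L hL) Ksite ∧ NE2PlusUnit c35 (bgVecInstance (d := d) L hL) Kunit inΛ unitDist) :
    S_N15 RRec := by
  intro F D g₀ os R hR
  obtain ⟨c35, p, Ksite, Kunit, inΛ, unitDist, hc35, hne2, hsite, hunit⟩ := hread F D g₀ os R hR
  rw [hne2]
  exact n15At_vectorPiece_background_of_layers hd hL hc35 p Ksite Kunit inΛ unitDist hsite hunit

/-- **`S_N15` FOR EVERY FIRST-ORDER-BACKGROUND READING** (the carriers of `n15At_vectorPiece_background₁_of_layers`). [bookkeeping] -/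
theorem s_N15_of_background₁Reading (hd : 1 ≤ d) (hL : 1 ≤ L) (RRec : RateRecordPred N)
    (hread : ∀ (F : T4Family) (D : Datum F N) (g₀ : ℕ → ℝ) (os : List (ULoop F)) (R : RateCarriers N), RRec F D g₀ os R →
      ∃ (c35 p : ℝ) (Ksite Kunit : ∀ j : VecIndexS d L, SiteKernel (bgVecInstance₁ (d := d) L hL j).gc (bgVecInstance₁ (d := d) L hL j).Bf)
        (inΛ : ∀ j : VecIndexS d L, (bgVecInstance₁ (d := d) L hL j).gc.Site → Prop)
        (unitDist : ∀ j : VecIndexS d L, (bgVecInstance₁ (d := d) L hL j).gc.Site → (bgVecInstance₁ (d := d) L hL j).gc.Site → ℝ),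
        0 < c35 ∧
        R.ne2 = { I := VecIndexS d L, c35 := c35, p := p, pi := bgVecInstance₁ (d := d) L hL, Kop := bgVecFamily₁4 (d := d) L hL,
                  Ksite := Ksite, Kunit := Kunit, inΛ := inΛ, unitDist := unitDist } ∧
        NE2PlusSite 4 p c35 (bgVecInstance₁ (d := d) L hL) Ksite ∧ NE2PlusUnit c35 (bgVecInstance₁ (d := d) L hL) Kunit inΛ unitDist) :
    S_N15 RRec := by
  intro F D g₀ os R hR
  obtain ⟨c35, p, Ksite, Kunit, inΛ, unitDist, hc35, hne2, hsite, hunit⟩ := hread F D g₀ os R hR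
  rw [hne2]
  exact n15At_vectorPiece_background₁_of_layers hd hL hc35 p Ksite Kunit inΛ unitDist hsite hunit

/-- **`S_N15` FOR EVERY GAUGE-FIELD READING** (the carriers of `n15At_vectorPiece_gauge_of_layers`). [bookkeeping] -/
theorem s_N15_of_gaugeReading (hd : 1 ≤ d) (hL : 1 ≤ L) (RRec : RateRecordPred N)
    (hread : ∀ (F : T4Family) (D : Datum F N) (g₀ : ℕ → ℝ) (os : List (ULoop F)) (R : RateCarriers N), RRec F D g₀ os R →
      ∃ (c35 p : ℝ) (Ksite Kunit : ∀ j : VecIndexS d L, SiteKernel (gaugeVecInstance (d := d) L hL j).gc (gaugeVecInstance (d := d) L hL j).Bf)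
        (inΛ : ∀ j : VecIndexS d L, (gaugeVecInstance (d := d) L hL j).gc.Site → Prop)
        (unitDist : ∀ j : VecIndexS d L, (gaugeVecInstance (d := d) L hL j).gc.Site → (gaugeVecInstance (d := d) L hL j).gc.Site → ℝ),
        0 < c35 ∧
        R.ne2 = { I := VecIndexS d L, c35 := c35, p := p, pi := gaugeVecInstance (d := d) L hL, Kop := gaugeVecFamily4 (d := d) L hL,
                  Ksite := Ksite, Kunit := Kunit, inΛ := inΛ, unitDist := unitDist } ∧
        NE2PlusSite 4 p c35 (gaugeVecInstance (d := d) L hL) Ksite ∧ NE2PlusUnit c35 (gaugeVecInstance (d := d) L hL) Kunit inΛ unitDist) :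
    S_N15 RRec := by
  intro F D g₀ os R hR
  obtain ⟨c35, p, Ksite, Kunit, inΛ, unitDist, hc35, hne2, hsite, hunit⟩ := hread F D g₀ os R hR
  rw [hne2]
  exact n15At_vectorPiece_gauge_of_layers hd hL hc35 p Ksite Kunit inΛ unitDist hsite hunit

end Closers

/-! ## §3 Guard: on these carriers the operator layer is never the reason `N15At` fails -/

section Guard

/-- **ON THE FIRST-ORDER BACKGROUND CARRIERS `N15At` FAILS IFF THE SITE OR THE UNIT LAYER FAILS** (the operator layer holds by
`VectorPiece.ne2PlusOperator_vectorPiece_background₁`): the honest residue of N15 on this family is the pair of displayed layers — no producer with the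
background live exists for them in the tree. [bookkeeping] -/
theorem not_n15At_iff_site_or_unit_fails_background₁ (hd : 1 ≤ d) (hL : 1 ≤ L) {c35 : ℝ} (hc35 : 0 < c35) (p : ℝ)
    (Ksite Kunit : ∀ j : VecIndexS d L, SiteKernel (bgVecInstance₁ (d := d) L hL j).gc (bgVecInstance₁ (d := d) L hL j).Bf)
    (inΛ : ∀ j : VecIndexS d L, (bgVecInstance₁ (d := d) L hL j).gc.Site → Prop)
    (unitDist : ∀ j : VecIndexS d L, (bgVecInstance₁ (d := d) L hL j).gc.Site → (bgVecInstance₁ (d := d) L hL j).gc.Site → ℝ) :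
    ¬ N15At { I := VecIndexS d L, c35 := c35, p := p, pi := bgVecInstance₁ (d := d) L hL, Kop := bgVecFamily₁4 (d := d) L hL,
              Ksite := Ksite, Kunit := Kunit, inΛ := inΛ, unitDist := unitDist } ↔
      ¬ NE2PlusSite 4 p c35 (bgVecInstance₁ (d := d) L hL) Ksite ∨ ¬ NE2PlusUnit c35 (bgVecInstance₁ (d := d) L hL) Kunit inΛ unitDist := by
  constructor
  · intro h
    by_cases hs : NE2PlusSite 4 p c35 (bgVecInstance₁ (d := d) L hL) Ksite
    · by_cases hu : NE2PlusUnit c35 (bgVecInstance₁ (d := d) L hL) Kunit inΛ unitDist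
      · exact absurd (n15At_vectorPiece_background₁_of_layers hd hL hc35 p Ksite Kunit inΛ unitDist hs hu) h
      · exact Or.inr hu
    · exact Or.inl hs
  · rintro (hs | hu) ⟨_, hsite, hunit⟩
    · exact hs hsite
    · exact hu hunit

end Guard

end Summit.QuantumFields.YangMills.Theorems.N15AtSpineCarriers

end
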